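import Summits.ResolutionOfSingularities.ResolutionOfSingularities.Theorems.FrobeniusLadderFInjectiveMacaulayficationKLocCell
import Summits.ResolutionOfSingularities.ResolutionOfSingularities.Theorems.FrobeniusLadderFInjectiveMacaulayficationCIFedderAtMaximalIdeal
import HarnessLib

/-!
# (G2, `Set.range` form) `hon' c` of `CICertificates.ciCertificates` at `r = 1` from point-Fedder / from the strata cover and the cells
# (crux `FInjectiveMacaulayfication`, road B; sequel of `…KLocCell.lean` = `L/w45a/ToricCertSig.lean` v1.1 `dfad821d8a675d80` §2/§3)

Support file for crux stmt-ResolutionOfSingularities-15315 (`FrobeniusLadder.FInjectiveMacaulayfication`), chain w45a, seat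
res-L1-w45a-stub-1. [OURS · L1 W4.5a] — NOT a statement of the manuscript [claim: Hironaka2017]; AI-written, weaker than expert
review. No statement of the manuscript is used.

`KLocCell.honQuot_of_kLocCells` is Sig §3 VERBATIM, written over `Ideal.span {g}`. The consumer `CICertificates.ciCertificates` (and
`CIConeFiModel.chartClause_of_quotientChartClause` / `CIConeFiModel.ciConeFiModelRel`) states its per-chart hypothesis `hon' c` over
`gs c : Fin r → k[Y]` and `Ideal.span (Set.range (gs c))`; at `r = 1` the two quotients `k[Y] ⧸ Ideal.span {g}` and
`k[Y] ⧸ Ideal.span (Set.range gs)` are different types (equal, not definitionally equal, ideals). This file restates the two glued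
theorems in the consumer's shape (res-L1-w45a-plan-1, Sig §3 docstring: «a prover may restate it over `g1 : Fin 1 → _` /
`Ideal.span (Set.range g1)` … planner accepts either»), so that `hon' c := honQuot_of_kLocCells_range p k n J (V c) (gs c) …` is an `exact`.

* `quotientChartClause_of_pointFedder_range` — `hon'` (`Set.range` form) from `gs 0 ≠ 0`, `Y_i ∤ gs 0` and Fedder's test at every
  `K`-point of `V(gs 0) ∩ V(θ(X_J))`: orbit binder by `KLocCell.isSMulRegular_localization_quotient_of_prime_not_dvd`; clause by the residue
  point, (C3a) `FrobeniusPowerOfFedderAt.frobeniusPower_of_fedderAt`, `FedderAtMaximalIdeal.fedder_criterion_maximalIdeal` upstairs in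
  `k[Y]_P ⧸ (g)` and transport along `k[Y]_P ⧸ (g) = k[Y]_P ⧸ (gs)·k[Y]_P ≃ (k[Y]/(gs))_(Q')`
  (`CIFedderAtMaximalIdeal.nonempty_quotLocalizationEquiv`, `DegreeZeroDescent.inlineClause_of_ringEquiv`);
* `honQuot_of_kLocCells_range` — cover + cells (`KLocCell.pointFedder_of_kLocCells`) ∘ the above.

No definitions, no named facts; glue. [cite: Fedder1983, Prop. 1.7 and Thm. 1.12 (criterion); folklore otherwise]
-/

-- single-problem summit: the doubled namespace component is forced
set_option linter.dupNamespace false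

noncomputable section

namespace Summit.ResolutionOfSingularities.ResolutionOfSingularities.Theorems.FInjectiveMacaulayfication.KLocCellRange

open MvPolynomial
open Summit.ResolutionOfSingularities.ResolutionOfSingularities.Theorems.FInjectiveMacaulayfication
open Literature.RingTheory.TightClosure KLocCell

section ChartRange

variable (p : ℕ) [Fact p.Prime] (k : Type) [Field k] [CharP k p] (n : ℕ)

/-- **`hon'` FROM POINT-FEDDER, `r = 1`, `Set.range` form.** As `quotientChartClause_of_pointFedder`, for `gs : Fin 1 → k[Y]`
(`g = gs 0`) over `Ideal.span (Set.range gs)` — the shape of `CIConeFiModel.chartClause_of_quotientChartClause` /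
`CICertificates.ciCertificates` / `CIConeFiModel.ciConeFiModelRel`. (ii) goes through `FedderAtMaximalIdeal.fedder_criterion_maximalIdeal`
upstairs and `CIFedderAtMaximalIdeal.nonempty_quotLocalizationEquiv`. [cite: Fedder1983, Prop. 1.7 and Thm. 1.12; folklore] -/
theorem quotientChartClause_of_pointFedder_range (J : Finset (Fin n)) (V : Matrix (Fin n) (Fin n) ℕ)
    (gs : Fin 1 → MvPolynomial (Fin n) k) (hg0 : gs 0 ≠ 0) (hX : ∀ i : Fin n, ¬ (MvPolynomial.X i ∣ gs 0))
    (hfed : ∀ (K : Type) [Field K] [Algebra k K] (b : Fin n → K), MvPolynomial.aeval b (gs 0) = 0 →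
      (∀ j ∈ J, MvPolynomial.aeval b (∏ i : Fin n, (X i : MvPolynomial (Fin n) k) ^ V i j) = 0) →
      (MvPolynomial.map (algebraMap k K) (gs 0)) ^ (p - 1) ∉
        Ideal.span (Set.range fun i : Fin n => (MvPolynomial.X i - MvPolynomial.C (b i)) ^ p)) :
    ∀ (Q' : Ideal (MvPolynomial (Fin n) k ⧸ Ideal.span (Set.range gs))) [Q'.IsMaximal],
      (∀ j ∈ J, Ideal.Quotient.mk (Ideal.span (Set.range gs))
        (aeval (fun j : Fin n => ∏ i : Fin n, (X i : MvPolynomial (Fin n) k) ^ V i j) (X j : MvPolynomial (Fin n) k)) ∈ Q') →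
        (∀ i : Fin n, (X i : MvPolynomial (Fin n) k) ∈ Q'.comap (Ideal.Quotient.mk (Ideal.span (Set.range gs))) →
          IsSMulRegular (Localization.AtPrime (Q'.comap (Ideal.Quotient.mk (Ideal.span (Set.range gs)))) ⧸
              (Ideal.span (Set.range gs)).map (algebraMap (MvPolynomial (Fin n) k)
                (Localization.AtPrime (Q'.comap (Ideal.Quotient.mk (Ideal.span (Set.range gs)))))))
            (algebraMap (MvPolynomial (Fin n) k)
              (Localization.AtPrime (Q'.comap (Ideal.Quotient.mk (Ideal.span (Set.range gs))))) (X i))) ∧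
        ∀ dd : ℕ, ringKrullDim (Localization.AtPrime Q') = dd → ∀ s : Fin dd → Localization.AtPrime Q',
          (Ideal.span (Set.range s)).radical.IsMaximal →
            RingTheory.Sequence.IsWeaklyRegular (Localization.AtPrime Q') (List.ofFn s) ∧
            ∀ y : Localization.AtPrime Q', (∃ e : ℕ, y ^ p ^ e ∈ Ideal.span
              ((fun z : Localization.AtPrime Q' => z ^ p ^ e) ''
                (Ideal.span (Set.range s) : Set (Localization.AtPrime Q')))) → y ∈ Ideal.span (Set.range s) := by
  intro Q' _ hθ
  classical
  have hrange : Set.range gs = {gs 0} := by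
    ext x
    simp only [Set.mem_range, Set.mem_singleton_iff]
    exact ⟨fun ⟨i, hi⟩ => by rw [← hi, Fin.fin_one_eq_zero i], fun h => ⟨0, h.symm⟩⟩
  have hspan : Ideal.span (Set.range gs) = Ideal.span {gs 0} := by rw [hrange]
  -- the contraction `P`, residue field `K`, residue point `b`
  set P : Ideal (MvPolynomial (Fin n) k) := Q'.comap (Ideal.Quotient.mk (Ideal.span (Set.range gs))) with hP_def
  haveI hPmax : P.IsMaximal := Ideal.comap_isMaximal_of_surjective _ Ideal.Quotient.mk_surjective
  refine ⟨fun i _ => isSMulRegular_localization_quotient_of_prime_not_dvd P (PrimeTransfer.prime_X i) (hX i) _ hspan, ?_⟩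
  letI : Field (MvPolynomial (Fin n) k ⧸ P) := Ideal.Quotient.field P
  have hgP : gs 0 ∈ P := by
    rw [hP_def, Ideal.mem_comap, Ideal.Quotient.eq_zero_iff_mem.mpr (Ideal.subset_span (Set.mem_range_self 0))]
    exact Q'.zero_mem
  have haev : ∀ q : MvPolynomial (Fin n) k,
      MvPolynomial.aeval (fun i : Fin n => Ideal.Quotient.mk P (MvPolynomial.X i)) q = Ideal.Quotient.mk P q := by
    intro q
    have h : (MvPolynomial.aeval (R := k) (fun i : Fin n => Ideal.Quotient.mk P (MvPolynomial.X i))) =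
        Ideal.Quotient.mkₐ k P := MvPolynomial.algHom_ext fun i => by
      rw [MvPolynomial.aeval_X, Ideal.Quotient.mkₐ_eq_mk]
    rw [h, Ideal.Quotient.mkₐ_eq_mk]
  have hgb : MvPolynomial.aeval (fun i : Fin n => Ideal.Quotient.mk P (MvPolynomial.X i)) (gs 0) = 0 := by
    rw [haev, Ideal.Quotient.eq_zero_iff_mem]; exact hgP
  have hθb : ∀ j ∈ J, MvPolynomial.aeval (fun i : Fin n => Ideal.Quotient.mk P (MvPolynomial.X i))
      (∏ i : Fin n, (X i : MvPolynomial (Fin n) k) ^ V i j) = 0 := by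
    intro j hj
    rw [haev, Ideal.Quotient.eq_zero_iff_mem, hP_def, Ideal.mem_comap]
    have h := hθ j hj
    rwa [MvPolynomial.aeval_X] at h
  have hfed' := hfed (MvPolynomial (Fin n) k ⧸ P) (fun i : Fin n => Ideal.Quotient.mk P (MvPolynomial.X i)) hgb hθb
  have hfrobP := FrobeniusPowerOfFedderAt.frobeniusPower_of_fedderAt p k n (gs 0) P hfed'
  obtain ⟨m, gens, hgens⟩ := Submodule.fg_iff_exists_fin_generating_family.mp
    ((isNoetherianRing_iff_ideal_fg _).mp inferInstance P)
  have hfed'' : gs 0 ^ (p - 1) ∉ Ideal.span (Set.range fun i : Fin m => gens i ^ p) := by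
    intro h
    apply hfrobP
    refine (Ideal.span_le.mpr ?_) h
    rintro _ ⟨i, rfl⟩
    exact pow_mem_frobeniusPower (by rw [← hgens]; exact Submodule.subset_span ⟨i, rfl⟩)
  -- the clause upstairs in `k[Y]_P ⧸ (g)`, then transport to `(k[Y]/(g))_(Q')`
  have hL := (FedderAtMaximalIdeal.fedder_criterion_maximalIdeal k n m p P gens hgens.symm (gs 0) hgP hg0).mpr hfed''
  have heq : Ideal.span {algebraMap (MvPolynomial (Fin n) k) (Localization.AtPrime P) (gs 0)} =
      (Ideal.span (Set.range gs)).map (algebraMap (MvPolynomial (Fin n) k) (Localization.AtPrime P)) := by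
    -- (no `rw [hrange]`: `Set.range gs` also occurs inside the type of `P`)
    apply le_antisymm
    · rw [Ideal.span_le, Set.singleton_subset_iff]
      exact Ideal.mem_map_of_mem _ (Ideal.subset_span (Set.mem_range_self 0))
    · rw [Ideal.map_le_iff_le_comap, Ideal.span_le]
      rintro _ ⟨i, rfl⟩
      obtain rfl : i = 0 := Fin.fin_one_eq_zero i
      rw [SetLike.mem_coe, Ideal.mem_comap]
      exact Ideal.mem_span_singleton_self _
  obtain ⟨e₂⟩ := CIFedderAtMaximalIdeal.nonempty_quotLocalizationEquiv (MvPolynomial (Fin n) k)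
    (Ideal.span (Set.range gs)) Q'
  have e : (Localization.AtPrime P ⧸
      Ideal.span {algebraMap (MvPolynomial (Fin n) k) (Localization.AtPrime P) (gs 0)}) ≃+*
        Localization.AtPrime Q' :=
    (Ideal.quotEquivOfEq heq).trans e₂
  exact DegreeZeroDescent.inlineClause_of_ringEquiv p
    (L := Localization.AtPrime P ⧸
      Ideal.span {algebraMap (MvPolynomial (Fin n) k) (Localization.AtPrime P) (gs 0)})
    (L' := Localization.AtPrime Q') e hL

/-- **(G2, glued, `Set.range` form) `hon' c` of `ciCertificates` at `r = 1` from the strata cover and the cells** — the same as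
`honQuot_of_kLocCells` for `gs : Fin 1 → k[Y]`, `g = gs 0`, over `Ideal.span (Set.range gs)`; plug as
`hon' c := KLocCell.honQuot_of_kLocCells_range p k n J (V c) (gs c) …`. [folklore; cite: Fedder1983, Prop. 1.7 and Thm. 1.12] -/
theorem honQuot_of_kLocCells_range (J : Finset (Fin n)) (V : Matrix (Fin n) (Fin n) ℕ) (gs : Fin 1 → MvPolynomial (Fin n) k)
    (hg0 : gs 0 ≠ 0) (hX : ∀ i : Fin n, ¬ (MvPolynomial.X i ∣ gs 0)) (SS : List (Finset (Fin n)))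
    (hcov : ∀ T : Finset (Fin n), (∀ j ∈ J, ∃ i ∈ T, 0 < V i j) → ∃ S ∈ SS, S ⊆ T)
    (hcells : ∀ S ∈ SS, ∃ (L : List ((Fin n →₀ ℕ) × MvPolynomial (Fin n) k)) (rr : List (MvPolynomial (Fin n) k))
        (t : Fin n → MvPolynomial (Fin n) k) (t₀ : MvPolynomial (Fin n) k),
        (L.map Prod.fst).Nodup ∧ (∀ e ∈ L, ∀ i : Fin n, e.1 i < p) ∧
        gs 0 ^ (p - 1) = (L.map fun e => MvPolynomial.monomial e.1 (1 : k) * MvPolynomial.expand p e.2).sum ∧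
        (1 : MvPolynomial (Fin n) k) = (List.zipWith (fun r e => r * MvPolynomial.expand p e.2) rr L).sum +
          ∑ i ∈ S, t i * MvPolynomial.X i + t₀ * gs 0) :
    ∀ (Q' : Ideal (MvPolynomial (Fin n) k ⧸ Ideal.span (Set.range gs))) [Q'.IsMaximal],
      (∀ j ∈ J, Ideal.Quotient.mk (Ideal.span (Set.range gs))
        (aeval (fun j : Fin n => ∏ i : Fin n, (X i : MvPolynomial (Fin n) k) ^ V i j) (X j : MvPolynomial (Fin n) k)) ∈ Q') →
        (∀ i : Fin n, (X i : MvPolynomial (Fin n) k) ∈ Q'.comap (Ideal.Quotient.mk (Ideal.span (Set.range gs))) →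
          IsSMulRegular (Localization.AtPrime (Q'.comap (Ideal.Quotient.mk (Ideal.span (Set.range gs)))) ⧸
              (Ideal.span (Set.range gs)).map (algebraMap (MvPolynomial (Fin n) k)
                (Localization.AtPrime (Q'.comap (Ideal.Quotient.mk (Ideal.span (Set.range gs)))))))
            (algebraMap (MvPolynomial (Fin n) k)
              (Localization.AtPrime (Q'.comap (Ideal.Quotient.mk (Ideal.span (Set.range gs))))) (X i))) ∧
        ∀ dd : ℕ, ringKrullDim (Localization.AtPrime Q') = dd → ∀ s : Fin dd → Localization.AtPrime Q',
          (Ideal.span (Set.range s)).radical.IsMaximal →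
            RingTheory.Sequence.IsWeaklyRegular (Localization.AtPrime Q') (List.ofFn s) ∧
            ∀ y : Localization.AtPrime Q', (∃ e : ℕ, y ^ p ^ e ∈ Ideal.span
              ((fun z : Localization.AtPrime Q' => z ^ p ^ e) ''
                (Ideal.span (Set.range s) : Set (Localization.AtPrime Q')))) → y ∈ Ideal.span (Set.range s) :=
  quotientChartClause_of_pointFedder_range p k n J V gs hg0 hX fun K _ _ b hgb hθ =>
    pointFedder_of_kLocCells p k n J V (gs 0) SS hcov hcells K b hgb hθ

end ChartRange

end Summit.ResolutionOfSingularities.ResolutionOfSingularities.Theorems.FInjectiveMacaulayfication.KLocCellRange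

end
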